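import Literature.Analysis.FluidPDE.CKNStep3Pairings
import Literature.Analysis.FluidPDE.ParabolicSingularPotentials
import Literature.Analysis.FluidPDE.ParabolicMaximalFunction
import HarnessLib

/-!
# Term bounds and geometric ingredients for the duality proof of (13.52)

Analysis/FluidPDE support file (everything proved) for the discharge of the named fact
`Literature.Analysis.FluidPDE.LemarieRieusset2016.step3_velocityBound`
(`CKNMorreyRepresentation.lean`; Lemarié-Rieusset 2016, §13.9 Step 3, (13.50)–(13.52),
pp. 474–475). Every term of the duality identity (`CKNMorreyDualIdentity.lean`) is
`∫_Q T · m · X` with `T` a derivative of the cut-off (continuous, bounded, vanishing off a compact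
`K`), `m` a monomial in the data (`⟪u, c⟫`, `⟪u, eᵢ⟫⟪u, eⱼ⟫`, `p`, `⟪f, c⟫`; integrable on `K`)
and `X` a caloric test field. This file turns the two kinds of bounds on `X` into bounds of the
terms:

* `ofReal_abs_setIntegral_term_le_riesz` — if `∫ Dat |X| ≤ C_X ∫ |g| 𝓘_α(Dat)` for all data
  (`CKNStep3Pairings.lean`), then `|∫_Q T m X| ≤ C_X B_T ∫ |g| 𝓘_α(Φ)` for any size function
  `Φ ≥ ‖m‖` on `K`;
* `ofReal_abs_setIntegral_term_le_offDiag` — if `|X| ≤ B_X ‖g‖₁` wherever `T ≠ 0`, then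
  `|∫_Q T m X| ≤ B_X B_T ‖g‖₁ ‖𝟙_K m‖₁`;

and records the geometry of the cylinders `Q₃ = Q_{r₃}(z₀) ⊆ Q₂ = Q_{r₂}(z₀)` used by the
assembly: the parabolic distance is `< 4r₂` between `Q₃` and `Q₂`
(`parabolicDist_lt_of_mem_cylinders`), the Riesz potential `𝓘₂(𝟙_{Q₂})` is bounded below on
`Q₃` (`exists_pos_le_parabolicRieszPotential_indicator`), the Riesz potentials of integrable data
supported in `Q₂` are integrable on `Q₃` (`lintegral_cylinder_parabolicRieszPotential_le`, from the
dyadic estimate of `ParabolicSingularPotentials.lean`), and `𝟙_{Q₂} ∈ ℳ₂^{q,τ}` for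
`0 < q ≤ τ`, `5(1 - q/τ) ≤ 5` (`isParabolicMorreyOn_one_indicator`).

## References

* P. G. Lemarié-Rieusset, *The Navier–Stokes Problem in the 21st Century*, CRC Press (2016),
  §13.9 Step 3, (13.50)–(13.52), pp. 474–475; p. 462 (Morrey norms on cylinders).
  [LemarieRieusset2016]
-/

noncomputable section

open MeasureTheory Set Function Filter Topology Metric Real
open scoped ENNReal NNReal RealInnerProductSpace

namespace Literature.Analysis.FluidPDE

/-! ### The two generic term bounds -/

section Terms

variable {Q : Set (ℝ × EuclideanSpace ℝ (Fin 3))} {K : Set (ℝ × EuclideanSpace ℝ (Fin 3))}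
  {T m X : ℝ × EuclideanSpace ℝ (Fin 3) → ℝ} {g : ℝ → EuclideanSpace ℝ (Fin 3) → ℝ}

/-- The size of a term: `‖T m X‖ = (‖T‖ ‖𝟙_K m‖) ‖X‖` when `T` vanishes off `K`. [folklore] -/
theorem enorm_term_eq (hT0 : ∀ z, z ∉ K → T z = 0) (z : ℝ × EuclideanSpace ℝ (Fin 3)) :
    ‖T z * m z * X z‖ₑ = (‖T z‖ₑ * ‖K.indicator m z‖ₑ) * ‖X z‖ₑ := by
  by_cases hz : z ∈ K
  · rw [indicator_of_mem hz, enorm_mul, enorm_mul]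
  · simp [hT0 z hz]

/-- The data function `Dat = ‖T‖ ‖𝟙_K m‖` of a term is a.e.-measurable. [folklore] -/
theorem aemeasurable_term_data (hT : Continuous T) (hm : Integrable (K.indicator m) volume) :
    AEMeasurable (fun z => ‖T z‖ₑ * ‖K.indicator m z‖ₑ) volume :=
  hT.measurable.enorm.aemeasurable.mul hm.aestronglyMeasurable.enorm

/-- The data function of a term is dominated by `B_T` times any size function `Φ ≥ ‖m‖` on `K`.
[folklore] -/
theorem term_data_le (hT0 : ∀ z, z ∉ K → T z = 0) {B : ℝ} (hTB : ∀ z, |T z| ≤ B)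
    {Φ : ℝ × EuclideanSpace ℝ (Fin 3) → ℝ≥0∞} (hΦ : ∀ z ∈ K, ‖m z‖ₑ ≤ Φ z)
    (z : ℝ × EuclideanSpace ℝ (Fin 3)) :
    ‖T z‖ₑ * ‖K.indicator m z‖ₑ ≤ ENNReal.ofReal B * Φ z := by
  by_cases hz : z ∈ K
  · rw [indicator_of_mem hz]
    refine mul_le_mul' ?_ (hΦ z hz)
    rw [← ofReal_norm, Real.norm_eq_abs]
    exact ENNReal.ofReal_le_ofReal (hTB z)
  · rw [hT0 z hz, enorm_zero, zero_mul]
    exact zero_le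

/-- **Term bound through a Riesz-potential pairing**: if `∫ Dat |X| ≤ C_X ∫ |g| 𝓘_α(Dat)` for all
a.e.-measurable data `Dat`, `T` is continuous with `|T| ≤ B_T` vanishing off `K`, `𝟙_K m` is
integrable and `‖m‖ ≤ Φ` on `K`, then `|∫_Q T m X| ≤ C_X B_T ∫ |g| 𝓘_α(Φ)`. [folklore] -/
theorem ofReal_abs_setIntegral_term_le_riesz {α C B : ℝ} (hC : 0 ≤ C)
    (hX : ∀ (Dat : ℝ × EuclideanSpace ℝ (Fin 3) → ℝ≥0∞), AEMeasurable Dat volume →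
      ∫⁻ z, Dat z * ‖X z‖ₑ ≤ ENNReal.ofReal C *
        ∫⁻ w : ℝ × EuclideanSpace ℝ (Fin 3), ‖g w.1 w.2‖ₑ * parabolicRieszPotential α Dat w)
    (hT : Continuous T) (hT0 : ∀ z, z ∉ K → T z = 0) (hTB : ∀ z, |T z| ≤ B)
    (hm : Integrable (K.indicator m) volume)
    {Φ : ℝ × EuclideanSpace ℝ (Fin 3) → ℝ≥0∞} (hΦ : ∀ z ∈ K, ‖m z‖ₑ ≤ Φ z) :
    ENNReal.ofReal |∫ z in Q, T z * m z * X z| ≤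
      ENNReal.ofReal (C * B) *
        ∫⁻ w : ℝ × EuclideanSpace ℝ (Fin 3), ‖g w.1 w.2‖ₑ * parabolicRieszPotential α Φ w := by
  have hB : 0 ≤ B := (abs_nonneg _).trans (hTB 0)
  set Dat : ℝ × EuclideanSpace ℝ (Fin 3) → ℝ≥0∞ := fun z => ‖T z‖ₑ * ‖K.indicator m z‖ₑ with hDat
  have hDm : AEMeasurable Dat volume := aemeasurable_term_data hT hm
  have hDle : ∀ z, Dat z ≤ ENNReal.ofReal B * Φ z := term_data_le hT0 hTB hΦ
  calc ENNReal.ofReal |∫ z in Q, T z * m z * X z|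
      ≤ ∫⁻ z in Q, ‖T z * m z * X z‖ₑ := by
        rw [← Real.norm_eq_abs, ofReal_norm]
        exact enorm_integral_le_lintegral_enorm _
    _ ≤ ∫⁻ z, ‖T z * m z * X z‖ₑ := setLIntegral_le_lintegral _ _
    _ = ∫⁻ z, Dat z * ‖X z‖ₑ := lintegral_congr fun z => enorm_term_eq hT0 z
    _ ≤ ENNReal.ofReal C *
          ∫⁻ w : ℝ × EuclideanSpace ℝ (Fin 3), ‖g w.1 w.2‖ₑ * parabolicRieszPotential α Dat w :=
        hX Dat hDm
    _ ≤ ENNReal.ofReal C * ∫⁻ w : ℝ × EuclideanSpace ℝ (Fin 3),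
          ‖g w.1 w.2‖ₑ * (ENNReal.ofReal B * parabolicRieszPotential α Φ w) := by
        refine mul_le_mul_right (lintegral_mono fun w => mul_le_mul_right ?_ _) _
        calc parabolicRieszPotential α Dat w
            ≤ parabolicRieszPotential α (fun z => ENNReal.ofReal B * Φ z) w :=
              parabolicRieszPotential_mono α hDle w
          _ = ENNReal.ofReal B * parabolicRieszPotential α Φ w :=
              parabolicRieszPotential_const_mul α _ ENNReal.ofReal_ne_top Φ w
    _ = ENNReal.ofReal (C * B) *
          ∫⁻ w : ℝ × EuclideanSpace ℝ (Fin 3), ‖g w.1 w.2‖ₑ * parabolicRieszPotential α Φ w := by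
        rw [ENNReal.ofReal_mul hC, mul_assoc]
        congr 1
        rw [← lintegral_const_mul' (ENNReal.ofReal B)
          (fun w : ℝ × EuclideanSpace ℝ (Fin 3) => ‖g w.1 w.2‖ₑ * parabolicRieszPotential α Φ w)
          ENNReal.ofReal_ne_top]
        refine lintegral_congr fun w => ?_
        ring

/-- **Term bound through an off-diagonal (bounded) field**: if `|X(z)| ≤ B_X ‖g‖₁` wherever
`T(z) ≠ 0`, then `|∫_Q T m X| ≤ B_X B_T ‖g‖₁ ‖𝟙_K m‖₁`. [folklore] -/
theorem ofReal_abs_setIntegral_term_le_offDiag {BX B : ℝ} (hBX : 0 ≤ BX)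
    (hX : ∀ z, T z ≠ 0 →
      ‖X z‖ₑ ≤ ENNReal.ofReal BX * ∫⁻ w : ℝ × EuclideanSpace ℝ (Fin 3), ‖g w.1 w.2‖ₑ)
    (hT : Continuous T) (hT0 : ∀ z, z ∉ K → T z = 0) (hTB : ∀ z, |T z| ≤ B)
    (hm : Integrable (K.indicator m) volume) :
    ENNReal.ofReal |∫ z in Q, T z * m z * X z| ≤
      ENNReal.ofReal (BX * B) * (∫⁻ w : ℝ × EuclideanSpace ℝ (Fin 3), ‖g w.1 w.2‖ₑ) *
        ∫⁻ z, ‖K.indicator m z‖ₑ := by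
  have hB : 0 ≤ B := (abs_nonneg _).trans (hTB 0)
  set Dat : ℝ × EuclideanSpace ℝ (Fin 3) → ℝ≥0∞ := fun z => ‖T z‖ₑ * ‖K.indicator m z‖ₑ with hDat
  have hDm : AEMeasurable Dat volume := aemeasurable_term_data hT hm
  have hDle : ∀ z, Dat z ≤ ENNReal.ofReal B * ‖K.indicator m z‖ₑ :=
    term_data_le hT0 hTB (Φ := fun z => ‖K.indicator m z‖ₑ) (fun z hz => by rw [indicator_of_mem hz])
  have hP : ∀ z, Dat z ≠ 0 →
      ‖X z‖ₑ ≤ ENNReal.ofReal BX * ∫⁻ w : ℝ × EuclideanSpace ℝ (Fin 3), ‖g w.1 w.2‖ₑ := by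
    intro z hz
    refine hX z fun hT' => hz ?_
    simp [hDat, hT']
  calc ENNReal.ofReal |∫ z in Q, T z * m z * X z|
      ≤ ∫⁻ z in Q, ‖T z * m z * X z‖ₑ := by
        rw [← Real.norm_eq_abs, ofReal_norm]
        exact enorm_integral_le_lintegral_enorm _
    _ ≤ ∫⁻ z, ‖T z * m z * X z‖ₑ := setLIntegral_le_lintegral _ _
    _ = ∫⁻ z, Dat z * ‖X z‖ₑ := lintegral_congr fun z => enorm_term_eq hT0 z
    _ ≤ (ENNReal.ofReal BX * ∫⁻ w : ℝ × EuclideanSpace ℝ (Fin 3), ‖g w.1 w.2‖ₑ) * ∫⁻ z, Dat z :=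
        lintegral_mul_le_of_le_const hDm hP
    _ ≤ (ENNReal.ofReal BX * ∫⁻ w : ℝ × EuclideanSpace ℝ (Fin 3), ‖g w.1 w.2‖ₑ) *
          (ENNReal.ofReal B * ∫⁻ z, ‖K.indicator m z‖ₑ) := by
        refine mul_le_mul_right ?_ _
        calc ∫⁻ z, Dat z ≤ ∫⁻ z, ENNReal.ofReal B * ‖K.indicator m z‖ₑ := lintegral_mono hDle
          _ = ENNReal.ofReal B * ∫⁻ z, ‖K.indicator m z‖ₑ :=
              lintegral_const_mul'' _ hm.aestronglyMeasurable.enorm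
    _ = ENNReal.ofReal (BX * B) * (∫⁻ w : ℝ × EuclideanSpace ℝ (Fin 3), ‖g w.1 w.2‖ₑ) *
          ∫⁻ z, ‖K.indicator m z‖ₑ := by
        rw [ENNReal.ofReal_mul hBX]; ring

end Terms

/-! ### Geometry of the cylinders `Q₃ ⊆ Q₂` -/

section Geometry

variable {z₀ : ℝ × EuclideanSpace ℝ (Fin 3)} {r₂ r₃ : ℝ}

/-- Points of `Q_{r₃}(z₀)` and `Q_{r₂}(z₀)`, `0 < r₃ ≤ r₂`, are at parabolic distance `< 4r₂`
(`|t - s| < 2r₂²`, `‖x - y‖ < 2r₂`, `√2 + 2 < 4`). [folklore] -/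
theorem parabolicDist_lt_of_mem_cylinders (hr₃ : 0 < r₃) (h : r₃ ≤ r₂)
    {z w : ℝ × EuclideanSpace ℝ (Fin 3)} (hz : z ∈ FluidPDE.parabolicCylinderCentered r₃ z₀)
    (hw : w ∈ FluidPDE.parabolicCylinderCentered r₂ z₀) : parabolicDist z w < 4 * r₂ := by
  have hr₂ : 0 < r₂ := hr₃.trans_le h
  rw [FluidPDE.mem_parabolicCylinderCentered] at hz hw
  rw [parabolicDist]
  have hsq : r₃ ^ 2 ≤ r₂ ^ 2 := pow_le_pow_left₀ hr₃.le h 2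
  have ht : |z.1 - w.1| < 4 * r₂ ^ 2 := by
    rw [abs_lt]; constructor <;> nlinarith [hz.1.1, hz.1.2, hw.1.1, hw.1.2]
  have h1 : Real.sqrt |z.1 - w.1| < 2 * r₂ := by
    rw [Real.sqrt_lt' (by positivity)]
    nlinarith
  have h2 : ‖z.2 - w.2‖ < 2 * r₂ := by
    calc ‖z.2 - w.2‖ = dist z.2 w.2 := (dist_eq_norm _ _).symm
      _ ≤ dist z.2 z₀.2 + dist w.2 z₀.2 := dist_triangle_right _ _ _
      _ < r₃ + r₂ := add_lt_add hz.2 hw.2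
      _ ≤ 2 * r₂ := by linarith
  linarith

/-- **`𝓘₂(𝟙_{Q₂})` is bounded below on `Q₃`**: for `0 < r₃ ≤ r₂` there is `c₀ > 0` (namely
`|Q₂| (4r₂)⁻³`) with `c₀ ≤ 𝓘₂(𝟙_{Q₂})(z)` for all `z ∈ Q₃`. [folklore] -/
theorem exists_pos_le_parabolicRieszPotential_indicator (hr₃ : 0 < r₃) (h : r₃ ≤ r₂) :
    ∃ c₀ : ℝ≥0∞, c₀ ≠ 0 ∧ c₀ ≠ ∞ ∧ ∀ z ∈ FluidPDE.parabolicCylinderCentered r₃ z₀,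
      c₀ ≤ parabolicRieszPotential 2
        ((FluidPDE.parabolicCylinderCentered r₂ z₀).indicator fun _ => (1 : ℝ≥0∞)) z := by
  have hr₂ : 0 < r₂ := hr₃.trans_le h
  set Q₂ := FluidPDE.parabolicCylinderCentered r₂ z₀ with hQ₂
  have hvol : volume Q₂ ≠ 0 := (volume_parabolicCylinderCentered_pos hr₂ z₀).ne'
  have hvolt : volume Q₂ ≠ ∞ := (volume_parabolicCylinderCentered_lt_top r₂ z₀).ne
  set κ : ℝ≥0∞ := (ENNReal.ofReal (4 * r₂) ^ ((5 : ℝ) - 2))⁻¹ with hκ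
  have hκ0 : κ ≠ 0 := ENNReal.inv_ne_zero.2 (ENNReal.rpow_ne_top_of_nonneg (by norm_num) ENNReal.ofReal_ne_top)
  have hκt : κ ≠ ∞ := ENNReal.inv_ne_top.2
    (ENNReal.rpow_pos (ENNReal.ofReal_pos.2 (by positivity)) ENNReal.ofReal_ne_top).ne'
  refine ⟨κ * volume Q₂, mul_ne_zero hκ0 hvol, ENNReal.mul_ne_top hκt hvolt, fun z hz => ?_⟩
  have hQ₂m : MeasurableSet Q₂ := (FluidPDE.isOpen_parabolicCylinderCentered r₂ z₀).measurableSet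
  calc κ * volume Q₂ = ∫⁻ w in Q₂, κ := by rw [setLIntegral_const, mul_comm]
    _ ≤ ∫⁻ w in Q₂, (ENNReal.ofReal (parabolicDist z w) ^ ((5 : ℝ) - 2))⁻¹ := by
        refine setLIntegral_mono' hQ₂m fun w hw => ?_
        refine ENNReal.inv_le_inv.2 (ENNReal.rpow_le_rpow ?_ (by norm_num))
        exact ENNReal.ofReal_le_ofReal (parabolicDist_lt_of_mem_cylinders hr₃ h hz hw).le
    _ = parabolicRieszPotential 2 (Q₂.indicator fun _ => (1 : ℝ≥0∞)) z := by
        rw [parabolicRieszPotential, ← lintegral_indicator hQ₂m]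
        refine lintegral_congr fun w => ?_
        by_cases hw : w ∈ Q₂
        · rw [indicator_of_mem hw, indicator_of_mem hw, one_mul]
        · rw [indicator_of_notMem hw, indicator_of_notMem hw, zero_mul]

/-- **`𝟙_{Q₂} ∈ ℳ₂^{q,τ}`** on `Q₂` whenever `0 < q` and `0 ≤ 5(1 - q/τ) ≤ 5`: the mass of a
cylinder of radius `r` inside `Q₂` is at most `min(|Q_r|, |Q₂|) ≤ M r^{5(1-q/τ)}`
(Lemarié-Rieusset 2016, p. 462: Morrey norms on cylinders). [cite: LemarieRieusset2016, §13.8 p. 462] -/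
theorem isParabolicMorreyOn_one_indicator (hr₂ : 0 < r₂) {q τ : ℝ} (hq : 0 < q)
    (hκ0 : 0 ≤ 5 * (1 - q / τ)) (hκ5 : 5 * (1 - q / τ) ≤ 5) :
    IsParabolicMorreyOn (FluidPDE.parabolicCylinderCentered r₂ z₀)
      ((FluidPDE.parabolicCylinderCentered r₂ z₀).indicator fun _ => (1 : ℝ≥0∞)) q τ := by
  set κ : ℝ := 5 * (1 - q / τ) with hκ
  set V : ℝ≥0∞ := volume (FluidPDE.parabolicCylinderCentered (1 : ℝ) (0 : ℝ × EuclideanSpace ℝ (Fin 3)))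
    with hV
  have hVt : V ≠ ∞ := (volume_parabolicCylinderCentered_lt_top 1 0).ne
  -- the constant: `V (1 + r₂⁵) (1 + r₂^{-κ})`, in `ℝ≥0`
  set M : ℝ≥0 := (V * ENNReal.ofReal ((1 + r₂ ^ 5) * (1 + r₂ ^ (-κ)))).toNNReal with hM
  refine ⟨M, fun z r hr => ?_⟩
  have hMeq : (M : ℝ≥0∞) = V * ENNReal.ofReal ((1 + r₂ ^ 5) * (1 + r₂ ^ (-κ))) := by
    rw [hM, ENNReal.coe_toNNReal (ENNReal.mul_ne_top hVt ENNReal.ofReal_ne_top)]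
  -- the integrand is at most `1`
  have hle1 : ∀ w, ((FluidPDE.parabolicCylinderCentered r₂ z₀).indicator (fun _ => (1 : ℝ≥0∞)) w) ^ q ≤ 1 := by
    intro w
    by_cases hw : w ∈ FluidPDE.parabolicCylinderCentered r₂ z₀
    · rw [indicator_of_mem hw, ENNReal.one_rpow]
    · rw [indicator_of_notMem hw, ENNReal.zero_rpow_of_pos hq]; exact zero_le
  have hvolr : volume (FluidPDE.parabolicCylinderCentered r z) = ENNReal.ofReal (r ^ 5) * V := by
    have := volume_parabolicCylinderCentered_smul hr one_pos (0 : ℝ × EuclideanSpace ℝ (Fin 3)) z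
    rw [mul_one] at this
    exact this
  have hvol₂ : volume (FluidPDE.parabolicCylinderCentered r₂ z₀) = ENNReal.ofReal (r₂ ^ 5) * V := by
    have := volume_parabolicCylinderCentered_smul hr₂ one_pos (0 : ℝ × EuclideanSpace ℝ (Fin 3)) z₀
    rw [mul_one] at this
    exact this
  calc ∫⁻ w in FluidPDE.parabolicCylinderCentered r z ∩ FluidPDE.parabolicCylinderCentered r₂ z₀,
        ((FluidPDE.parabolicCylinderCentered r₂ z₀).indicator (fun _ => (1 : ℝ≥0∞)) w) ^ q
      ≤ ∫⁻ w in FluidPDE.parabolicCylinderCentered r z ∩ FluidPDE.parabolicCylinderCentered r₂ z₀, 1 :=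
        lintegral_mono fun w => hle1 w
    _ = volume (FluidPDE.parabolicCylinderCentered r z ∩ FluidPDE.parabolicCylinderCentered r₂ z₀) := by
        rw [setLIntegral_const, one_mul]
    _ ≤ min (ENNReal.ofReal (r ^ 5) * V) (ENNReal.ofReal (r₂ ^ 5) * V) := by
        refine le_min ?_ ?_
        · rw [← hvolr]; exact measure_mono inter_subset_left
        · rw [← hvol₂]; exact measure_mono inter_subset_right
    _ ≤ (M : ℝ≥0∞) * ENNReal.ofReal (r ^ κ) := by
        rw [hMeq]
        by_cases hr1 : r ≤ r₂
        · -- small radii: `r⁵ ≤ r₂^{5-κ} r^κ ≤ (1 + r₂⁵)(1 + r₂^{-κ}) r^κ`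
          calc min (ENNReal.ofReal (r ^ 5) * V) (ENNReal.ofReal (r₂ ^ 5) * V)
              ≤ ENNReal.ofReal (r ^ 5) * V := min_le_left _ _
            _ = V * ENNReal.ofReal (r ^ 5) := mul_comm _ _
            _ ≤ V * (ENNReal.ofReal ((1 + r₂ ^ 5) * (1 + r₂ ^ (-κ))) * ENNReal.ofReal (r ^ κ)) := by
                refine mul_le_mul_right ?_ _
                rw [← ENNReal.ofReal_mul (by positivity)]
                refine ENNReal.ofReal_le_ofReal ?_
                -- `r⁵ = r^{5-κ} r^κ ≤ r₂^{5-κ} r^κ` and `r₂^{5-κ} ≤ (1+r₂⁵)(1+r₂^{-κ})`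
                have h1 : r ^ (5 : ℝ) = r ^ ((5 : ℝ) - κ) * r ^ κ := by
                  rw [← Real.rpow_add hr]; ring_nf
                have h2 : r ^ ((5 : ℝ) - κ) ≤ r₂ ^ ((5 : ℝ) - κ) :=
                  Real.rpow_le_rpow hr.le hr1 (by linarith)
                have h3 : r₂ ^ ((5 : ℝ) - κ) = r₂ ^ (5 : ℝ) * r₂ ^ (-κ) := by
                  rw [← Real.rpow_add hr₂]; ring_nf
                have h4 : r₂ ^ (5 : ℝ) * r₂ ^ (-κ) ≤ (1 + r₂ ^ 5) * (1 + r₂ ^ (-κ)) := by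
                  have a1 : r₂ ^ (5 : ℝ) ≤ 1 + r₂ ^ 5 := by
                    rw [show (5 : ℝ) = ((5 : ℕ) : ℝ) by norm_num, Real.rpow_natCast]; linarith
                  have a2 : r₂ ^ (-κ) ≤ 1 + r₂ ^ (-κ) := by linarith
                  exact mul_le_mul a1 a2 (Real.rpow_nonneg hr₂.le _) (by positivity)
                calc r ^ 5 = r ^ (5 : ℝ) := by
                      rw [show (5 : ℝ) = ((5 : ℕ) : ℝ) by norm_num, Real.rpow_natCast]
                  _ = r ^ ((5 : ℝ) - κ) * r ^ κ := h1
                  _ ≤ r₂ ^ ((5 : ℝ) - κ) * r ^ κ :=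
                      mul_le_mul_of_nonneg_right h2 (Real.rpow_nonneg hr.le _)
                  _ ≤ (1 + r₂ ^ 5) * (1 + r₂ ^ (-κ)) * r ^ κ := by
                      rw [h3]
                      exact mul_le_mul_of_nonneg_right h4 (Real.rpow_nonneg hr.le _)
            _ = V * ENNReal.ofReal ((1 + r₂ ^ 5) * (1 + r₂ ^ (-κ))) * ENNReal.ofReal (r ^ κ) := by
                rw [mul_assoc]
        · -- large radii: `r₂⁵ ≤ (1 + r₂⁵)(1 + r₂^{-κ}) r^κ` since `r^κ ≥ r₂^κ ≥ …`
          push Not at hr1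
          calc min (ENNReal.ofReal (r ^ 5) * V) (ENNReal.ofReal (r₂ ^ 5) * V)
              ≤ ENNReal.ofReal (r₂ ^ 5) * V := min_le_right _ _
            _ = V * ENNReal.ofReal (r₂ ^ 5) := mul_comm _ _
            _ ≤ V * (ENNReal.ofReal ((1 + r₂ ^ 5) * (1 + r₂ ^ (-κ))) * ENNReal.ofReal (r ^ κ)) := by
                refine mul_le_mul_right ?_ _
                rw [← ENNReal.ofReal_mul (by positivity)]
                refine ENNReal.ofReal_le_ofReal ?_
                have h2 : r₂ ^ κ ≤ r ^ κ := Real.rpow_le_rpow hr₂.le hr1.le hκ0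
                have h3 : (1 : ℝ) ≤ (1 + r₂ ^ (-κ)) * r₂ ^ κ := by
                  rw [add_mul, ← Real.rpow_add hr₂, neg_add_cancel, Real.rpow_zero, one_mul]
                  linarith [Real.rpow_nonneg hr₂.le κ]
                calc r₂ ^ 5 = r₂ ^ 5 * 1 := (mul_one _).symm
                  _ ≤ (1 + r₂ ^ 5) * ((1 + r₂ ^ (-κ)) * r₂ ^ κ) :=
                      mul_le_mul (by linarith) h3 zero_le_one (by positivity)
                  _ = (1 + r₂ ^ 5) * (1 + r₂ ^ (-κ)) * r₂ ^ κ := by ring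
                  _ ≤ (1 + r₂ ^ 5) * (1 + r₂ ^ (-κ)) * r ^ κ :=
                      mul_le_mul_of_nonneg_left h2 (by positivity)
            _ = V * ENNReal.ofReal ((1 + r₂ ^ 5) * (1 + r₂ ^ (-κ))) * ENNReal.ofReal (r ^ κ) := by
                rw [mul_assoc]

/-- **Riesz potentials of integrable data supported in `Q₂` are integrable on `Q₃`**: for
`0 < α < 5` (so that `m = 5 - α ∈ (0, 5)`) and `Φ` a.e.-measurable, vanishing off
`Q₂ = Q_{r₂}(z₀)`, `∫_{Q₃} 𝓘_α(Φ) ≤ C(α, r₂) ∫ Φ` (Tonelli; for `w ∈ Q₂` the cylinder `Q₃`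
lies in the parabolic ball of radius `4r₂` about `w`, on which
`∫ δ₂(z, w)^{-(5-α)} dz ≤ C (4r₂)^{α}` by the dyadic estimate of
`ParabolicSingularPotentials.lean` with data `1`). [folklore] -/
theorem lintegral_cylinder_parabolicRieszPotential_le (hr₃ : 0 < r₃) (h : r₃ ≤ r₂) {α : ℝ}
    (hα0 : 0 < α) (hα5 : α < 5) {Φ : ℝ × EuclideanSpace ℝ (Fin 3) → ℝ≥0∞}
    (hΦ : AEMeasurable Φ volume)
    (hΦ0 : ∀ w, w ∉ FluidPDE.parabolicCylinderCentered r₂ z₀ → Φ w = 0) :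
    ∃ C : ℝ≥0∞, C ≠ ∞ ∧
      ∫⁻ z in FluidPDE.parabolicCylinderCentered r₃ z₀, parabolicRieszPotential α Φ z ≤
        C * ∫⁻ w, Φ w := by
  have hr₂ : 0 < r₂ := hr₃.trans_le h
  -- the `L¹`-Morrey bound of the constant data `1`: `∫∫_{Q_r(c)} 1 = |Q_r| = 2|B₁| r⁵`
  set B : ℝ := 2 * (volume (ball (0 : EuclideanSpace ℝ (Fin 3)) 1)).toReal with hBdef
  have hB : 0 ≤ B := by positivity
  have hMor : ∀ (c : ℝ × EuclideanSpace ℝ (Fin 3)) (r : ℝ), 0 < r →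
      ∫⁻ w in FluidPDE.parabolicCylinderCentered r c, ‖(fun _ : ℝ × EuclideanSpace ℝ (Fin 3) => (1 : ℝ)) w‖ₑ ≤
        ENNReal.ofReal (B * r ^ (5 : ℝ)) := by
    intro c r hr
    have h1 : (fun w : ℝ × EuclideanSpace ℝ (Fin 3) =>
        ‖(fun _ : ℝ × EuclideanSpace ℝ (Fin 3) => (1 : ℝ)) w‖ₑ) = fun _ => 1 := by
      funext w; simp
    refine le_of_eq ?_
    rw [h1, setLIntegral_const, one_mul, volume_parabolicCylinderCentered hr c, hBdef,
      show (5 : ℝ) = ((5 : ℕ) : ℝ) by norm_num, Real.rpow_natCast,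
      show 2 * (volume (ball (0 : EuclideanSpace ℝ (Fin 3)) 1)).toReal * r ^ 5 =
        (2 * r ^ 5) * (volume (ball (0 : EuclideanSpace ℝ (Fin 3)) 1)).toReal by ring,
      ENNReal.ofReal_mul (by positivity : (0 : ℝ) ≤ 2 * r ^ 5),
      ENNReal.ofReal_toReal (measure_ball_lt_top (x := (0 : EuclideanSpace ℝ (Fin 3))) (r := 1)).ne]
  set m : ℝ := 5 - α with hm
  have hm0 : 0 < m := by rw [hm]; linarith
  have hm5 : m < 5 := by rw [hm]; linarith
  set Cd : ℝ := 2 ^ (5 : ℝ) * 2 ^ m * (1 - ((2 : ℝ) ^ ((5 : ℝ) - m))⁻¹)⁻¹ * B * (4 * r₂) ^ ((5 : ℝ) - m)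
    with hCd
  -- the inner bound, uniform in `w ∈ Q₂`
  have hinner : ∀ w ∈ FluidPDE.parabolicCylinderCentered r₂ z₀,
      ∫⁻ z in FluidPDE.parabolicCylinderCentered r₃ z₀,
        (ENNReal.ofReal (parabolicDist z w) ^ (5 - α))⁻¹ ≤ ENNReal.ofReal Cd := by
    intro w hw
    have hsub : FluidPDE.parabolicCylinderCentered r₃ z₀ ⊆ parabolicBall w (4 * r₂) := fun z hz => by
      rw [mem_parabolicBall, ← parabolicDist_eq_parabolicNorm, parabolicDist_comm]
      exact parabolicDist_lt_of_mem_cylinders hr₃ h hz hw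
    have key := lintegral_parabolicBall_rpow_neg_mul_le (F := fun _ : ℝ × EuclideanSpace ℝ (Fin 3) => (1 : ℝ))
      hB hm0 hm5 (by simp)
      hMor w (by positivity : 0 < 4 * r₂)
    simp only [enorm_one, mul_one] at key
    refine le_trans (lintegral_mono_set hsub) (le_trans (lintegral_mono_ae ?_) key)
    -- the inequality holds off the single point `w`
    have hsing : volume ({w} : Set (ℝ × EuclideanSpace ℝ (Fin 3))) = 0 := by
      rw [show ({w} : Set (ℝ × EuclideanSpace ℝ (Fin 3))) = {w.1} ×ˢ {w.2} by
          ext z; simp [Prod.ext_iff],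
        Measure.volume_eq_prod, Measure.prod_prod, Real.volume_singleton, zero_mul]
    have hnull : (volume.restrict (parabolicBall w (4 * r₂))) {w} = 0 :=
      le_antisymm ((Measure.restrict_apply_le _ _).trans hsing.le) (zero_le)
    have hae : ∀ᵐ z ∂(volume.restrict (parabolicBall w (4 * r₂))), z ≠ w := by
      rw [ae_iff]
      refine measure_mono_null (fun z hz => ?_) hnull
      simp only [ne_eq, Decidable.not_not, mem_setOf_eq] at hz
      exact hz
    filter_upwards [hae] with z hzw
    have hpos : 0 < parabolicDist z w :=
      lt_of_le_of_ne (parabolicDist_nonneg z w) (fun h0 => hzw (parabolicDist_eq_zero.1 h0.symm))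
    rw [← parabolicDist_eq_parabolicNorm, parabolicDist_comm w z, hm, Real.rpow_neg hpos.le,
      ENNReal.ofReal_inv_of_pos (Real.rpow_pos_of_pos hpos _), ENNReal.ofReal_rpow_of_pos hpos]
  refine ⟨ENNReal.ofReal Cd, ENNReal.ofReal_ne_top, ?_⟩
  -- Tonelli
  have hQ₃m : MeasurableSet (FluidPDE.parabolicCylinderCentered r₃ z₀) :=
    (FluidPDE.isOpen_parabolicCylinderCentered r₃ z₀).measurableSet
  set Kf : (ℝ × EuclideanSpace ℝ (Fin 3)) × (ℝ × EuclideanSpace ℝ (Fin 3)) → ℝ≥0∞ :=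
    fun p => (ENNReal.ofReal (parabolicDist p.1 p.2) ^ (5 - α))⁻¹ with hKf
  have hKfm : Measurable Kf := measurable_parabolicRieszKernel α
  have hF : AEMeasurable (fun p : (ℝ × EuclideanSpace ℝ (Fin 3)) × (ℝ × EuclideanSpace ℝ (Fin 3)) =>
      Φ p.2 * Kf (p.1, p.2)) ((volume.restrict (FluidPDE.parabolicCylinderCentered r₃ z₀)).prod volume) :=
    ((hΦ.comp_quasiMeasurePreserving Measure.quasiMeasurePreserving_snd).mul hKfm.aemeasurable)
  calc ∫⁻ z in FluidPDE.parabolicCylinderCentered r₃ z₀, parabolicRieszPotential α Φ z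
      = ∫⁻ z in FluidPDE.parabolicCylinderCentered r₃ z₀, ∫⁻ w, Φ w * Kf (z, w) := rfl
    _ = ∫⁻ w, ∫⁻ z in FluidPDE.parabolicCylinderCentered r₃ z₀, Φ w * Kf (z, w) :=
        lintegral_lintegral_swap hF
    _ = ∫⁻ w, Φ w * ∫⁻ z in FluidPDE.parabolicCylinderCentered r₃ z₀, Kf (z, w) := by
        refine lintegral_congr fun w => ?_
        have hm' : AEMeasurable (fun z : ℝ × EuclideanSpace ℝ (Fin 3) => Kf (z, w))
            (volume.restrict (FluidPDE.parabolicCylinderCentered r₃ z₀)) :=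
          (hKfm.comp (measurable_id.prodMk measurable_const)).aemeasurable
        rw [lintegral_const_mul'' (Φ w) hm']
    _ ≤ ∫⁻ w, Φ w * ENNReal.ofReal Cd := by
        refine lintegral_mono fun w => ?_
        by_cases hw : w ∈ FluidPDE.parabolicCylinderCentered r₂ z₀
        · exact mul_le_mul_right (hinner w hw) _
        · rw [hΦ0 w hw, zero_mul, zero_mul]
    _ = ENNReal.ofReal Cd * ∫⁻ w, Φ w := by
        rw [lintegral_mul_const'' _ hΦ, mul_comm]

end Geometry

end Literature.Analysis.FluidPDE
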